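import Literature.AlgebraicGeometry.Resolution.QuadraticTransforms
import Mathlib.RingTheory.IntegralClosure.Algebra.Basic
import Mathlib.RingTheory.IntegralClosure.IsIntegral.Basic
import Mathlib.Algebra.Polynomial.Reverse
import Mathlib.Algebra.Polynomial.Inductions
import Mathlib.RingTheory.AdjoinRoot
import HarnessLib

/-!
# Crux `Steer` (stmt-ResolutionOfSingularities-16345), chain W4.1, R2 σ_top line: K(2) realisation, layer 2b —
# adjoining the torsor generators to a quadratic transform gives a quadratic transform (Theses-free helper)

OURS (campaign `res-hironaka`, rung L ★L-G4, slot W4.1, chain W4.1, seat `res-type-026`, TAKEN from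
res-L1-type-o8's realisation layer of K(2) by the split on STATUS 2026-08-27T05:25–05:47Z; replaces the role of no
printed item; NOT a statement of the manuscript under review; AI review is weaker than expert review).

The ADJOIN STEP of the realisation of a radicand chain (`L/w41/Sketch-R2-steered.lean` fb4f9514a6cb98fe §3.1,
`NoEternalIsolatedRadicandChain`) as a branch of quadratic transforms (Cutkosky §2.1) of the torsor germs inside one
field `K`: if `A → A₁` is a quadratic transform of local subrings of `K` with `𝔪_A · A₁ = (x₁)`, and
`θ₀, θ₁ ∈ K` are radicals `θ₀^p = f₀ ∈ A`, `θ₁^p = f₁ ∈ A₁` linked by the strict-transform law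
`θ₀ = x₁ θ₁ + g` (`g ∈ A`), then `B := A[θ₀] → B₁ := A₁[θ₁]` is a quadratic transform (provided `B`, `B₁`
are local — in the application they are the torsor germs, local by construction). Pure statements about
subrings of a field; no definitions.

* `RadicandChainAdjoin.isIntegral_of_mem_closure` — `A[θ]` is integral over `A` when `θ^p ∈ A`.
* `RadicandChainAdjoin.inv_mem_of_isIntegral` — if `a ∈ A` and `a⁻¹` is integral over `A` then `a⁻¹ ∈ A`
  (reverse the integral equation: `1 = -a · s(a)`).
* `RadicandChainAdjoin.mem_maximalIdeal_of_integral` — along an integral extension `A ≤ C` of local subrings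
  non-units stay non-units.
* `RadicandChainAdjoin.isQuadraticTransform_adjoin` — the adjoin step. Along the parameter `x ∈ 𝔪_A` of
  `A → A₁`: `𝔪_B ⊆ 𝔪_A + (θ₀ − g)B` (every `b ∈ A[θ₀]` is `a + (θ₀ − g)c`, and `θ₀ − g = x₁θ₁` is a
  non-unit of `B₁ ⊇ B`), so `B[𝔪_B/x] ⊆ B₁` (`𝔪_A/x ⊆ A₁`, `(θ₀ − g)/x = (x₁/x) θ₁` with `x₁/x ∈ A₁` from
  `x₁ ∈ 𝔪_A A₁ = x A₁`); every element of `A₁[θ₁]` is a fraction over `B[𝔪_B/x]` with denominator invertible in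
  `B₁` (`A₁` is, and `θ₁ = (x/x₁) · (θ₀ − g)/x` with `x/x₁ ∈ A₁` from `x ∈ (x₁)`); and `B₁` dominates `B`
  (`𝔪_B ⊆ 𝔪_{A₁}B₁ + x₁ B₁ ⊆ 𝔪_{B₁}`).
* `RadicandChainAdjoin.range_adjoinRoot_lift` — the image of `S[X]/(F) → K`, `X ↦ θ`, is `i(S)[θ]`
  (`Subring.closure (i(S) ∪ {θ})`), the form in which the torsor germs are realised.

[cite: Cutkosky2014, §2.1] [folklore]
-/

noncomputable section

-- `Summit.<S>.<S>.…` duplicates the summit name by design (single-problem summit).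
set_option linter.dupNamespace false

open IsLocalRing

namespace Summit.ResolutionOfSingularities.ResolutionOfSingularities.Theorems.SwitchingDichotomy

open Literature.AlgebraicGeometry.Resolution

namespace RadicandChainAdjoin

universe u v

section Integral

variable {K : Type u} [Field K]

/-- `A[θ] = Subring.closure (A ∪ {θ})` is integral over `A` when `θ^p ∈ A` (`p ≠ 0`). [folklore] -/
theorem isIntegral_of_mem_closure (A : Subring K) {p : ℕ} (hp : p ≠ 0) {θ : K} (f : A)
    (hθ : θ ^ p = (f : K)) {c : K} (hc : c ∈ Subring.closure ((A : Set K) ∪ {θ})) :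
    IsIntegral A c := by
  have hθint : IsIntegral A θ := by
    refine ⟨Polynomial.X ^ p - Polynomial.C f, Polynomial.monic_X_pow_sub_C f hp, ?_⟩
    rw [Polynomial.eval₂_sub, Polynomial.eval₂_X_pow, Polynomial.eval₂_C, hθ, sub_eq_zero]
    rfl
  have hle : Subring.closure ((A : Set K) ∪ {θ}) ≤ (integralClosure A K).toSubring := by
    refine Subring.closure_le.mpr ?_
    rintro z (hz | hz)
    · show IsIntegral A (algebraMap A K ⟨z, hz⟩)
      exact isIntegral_algebraMap
    · rw [Set.mem_singleton_iff] at hz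
      rw [hz]
      exact hθint
  exact hle hc

/-- If `a ∈ A ⊆ K` and `a⁻¹` is integral over `A` then `a⁻¹ ∈ A`: reversing a monic relation
`q(a⁻¹) = 0` gives `s(a) · a + 1 = 0` with `s ∈ A[X]`, so `a⁻¹ = -s(a) ∈ A`. [folklore] -/
theorem inv_mem_of_isIntegral (A : Subring K) {a : K} (ha : a ∈ A) (hint : IsIntegral A a⁻¹) :
    a⁻¹ ∈ A := by
  rcases eq_or_ne a 0 with rfl | ha0
  · rw [inv_zero]; exact A.zero_mem
  obtain ⟨q, hqm, hq0⟩ := hint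
  haveI : Invertible (a⁻¹) := invertibleOfNonzero (inv_ne_zero ha0)
  have hr : Polynomial.eval₂ (algebraMap A K) a q.reverse = 0 := by
    have h := (Polynomial.eval₂_reverse_eq_zero_iff (algebraMap A K) a⁻¹ q).mpr hq0
    rwa [invOf_eq_inv, inv_inv] at h
  have hc0 : q.reverse.coeff 0 = 1 := by
    rw [Polynomial.coeff_zero_reverse, hqm.leadingCoeff]
  have hsplit := Polynomial.divX_mul_X_add q.reverse
  rw [hc0] at hsplit
  set s : K := Polynomial.eval₂ (algebraMap A K) a q.reverse.divX with hs
  have h1 : s * a + 1 = 0 := by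
    have h2 := congrArg (Polynomial.eval₂ (algebraMap A K) a) hsplit
    rw [Polynomial.eval₂_add, Polynomial.eval₂_mul, Polynomial.eval₂_X, Polynomial.eval₂_C, map_one,
      hr] at h2
    exact h2
  have hsA : s ∈ A := by
    have h3 : s = algebraMap A K (Polynomial.eval ⟨a, ha⟩ q.reverse.divX) := by
      rw [hs, ← Polynomial.eval₂_hom]
      rfl
    rw [h3]
    exact (Polynomial.eval (⟨a, ha⟩ : A) q.reverse.divX).2
  have h4 : a * (-s) = 1 := by linear_combination (-1 : K) * h1
  rw [inv_eq_of_mul_eq_one_right h4]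
  exact A.neg_mem hsA

/-- Along an INTEGRAL extension `A ≤ C` of local subrings of `K`, elements of `𝔪_A` lie in `𝔪_C` (a unit of
`C` lying in `A` has its inverse integral over `A`, hence in `A`). [folklore] -/
theorem mem_maximalIdeal_of_integral {A C : Subring K} [IsLocalRing A] [IsLocalRing C] (hAC : A ≤ C)
    (hint : ∀ c ∈ C, IsIntegral A c) {y : K} (hyA : y ∈ A) (hy : (⟨y, hyA⟩ : A) ∈ maximalIdeal A) :
    (⟨y, hAC hyA⟩ : C) ∈ maximalIdeal C := by
  rw [mem_maximalIdeal_iff_inv_not_mem] at hy ⊢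
  rcases hy with hy | hy
  · exact Or.inl hy
  · exact Or.inr fun hyC => hy (inv_mem_of_isIntegral A hyA (hint _ hyC))

end Integral

section Adjoin

variable {K : Type u} [Field K]

/-- **The adjoin step.** Let `A → A₁` be a quadratic transform of local subrings of the field `K` with
`𝔪_A · A₁ = (x₁)`, and let `θ₀, θ₁ ∈ K` with `θ₀^p = f₀ ∈ A`, `θ₁^p = f₁ ∈ A₁` (`p ≠ 0`) and
`θ₀ = x₁ θ₁ + g`, `g ∈ A` (the strict-transform law of the torsor generator). If `B = A[θ₀]` and
`B₁ = A₁[θ₁]` are local, then `B → B₁` is a quadratic transform (along the parameter of `A → A₁`). See the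
module docstring for the proof. [cite: Cutkosky2014, §2.1] [folklore] -/
theorem isQuadraticTransform_adjoin {A A₁ B B₁ : Subring K}
    [IsLocalRing A] [IsLocalRing A₁] [IsLocalRing B] [IsLocalRing B₁]
    (hAQ : IsQuadraticTransform A A₁) (hle : A ≤ A₁)
    {p : ℕ} (hp : p ≠ 0) {θ₀ θ₁ : K} (f₀ g : A) (f₁ x₁ : A₁)
    (hθ₀ : θ₀ ^ p = (f₀ : K)) (hθ₁ : θ₁ ^ p = (f₁ : K)) (hrel : θ₀ = (x₁ : K) * θ₁ + (g : K))
    (hspan : Ideal.span ((fun y : A => (⟨(y : K), hle y.2⟩ : A₁)) '' (maximalIdeal A : Set A)) =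
      Ideal.span {x₁})
    (hB : B = Subring.closure ((A : Set K) ∪ {θ₀}))
    (hB₁ : B₁ = Subring.closure ((A₁ : Set K) ∪ {θ₁})) :
    IsQuadraticTransform B B₁ := by
  obtain ⟨_, x, hx, hx0, _, hbl, hfrac, hdom⟩ := hAQ
  have hx0K : (x : K) ≠ 0 := fun h => hx0 (Subtype.ext h)
  -- ### inclusions
  have hAB : A ≤ B := by
    rw [hB]; exact fun z hz => Subring.subset_closure (Or.inl hz)
  have hθ₀B : θ₀ ∈ B := by
    rw [hB]; exact Subring.subset_closure (Or.inr rfl)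
  have hA₁B₁ : A₁ ≤ B₁ := by
    rw [hB₁]; exact fun z hz => Subring.subset_closure (Or.inl hz)
  have hθ₁B₁ : θ₁ ∈ B₁ := by
    rw [hB₁]; exact Subring.subset_closure (Or.inr rfl)
  have hBB₁ : B ≤ B₁ := by
    rw [hB]
    refine Subring.closure_le.mpr ?_
    rintro z (hz | hz)
    · exact hA₁B₁ (hle hz)
    · rw [Set.mem_singleton_iff] at hz
      rw [hz, hrel]
      exact B₁.add_mem (B₁.mul_mem (hA₁B₁ x₁.2) hθ₁B₁) (hA₁B₁ (hle g.2))
  -- ### integrality and maximal ideals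
  have hintB : ∀ c ∈ B, IsIntegral A c := fun c hc =>
    isIntegral_of_mem_closure A hp f₀ hθ₀ (hB ▸ hc)
  have hintB₁ : ∀ c ∈ B₁, IsIntegral A₁ c := fun c hc =>
    isIntegral_of_mem_closure A₁ hp f₁ hθ₁ (hB₁ ▸ hc)
  have hmAB : ∀ y : A, y ∈ maximalIdeal A → (⟨(y : K), hAB y.2⟩ : B) ∈ maximalIdeal B :=
    fun y hy => mem_maximalIdeal_of_integral hAB hintB y.2 hy
  have hmA₁B₁ : ∀ y : A₁, y ∈ maximalIdeal A₁ → (⟨(y : K), hA₁B₁ y.2⟩ : B₁) ∈ maximalIdeal B₁ :=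
    fun y hy => mem_maximalIdeal_of_integral hA₁B₁ hintB₁ y.2 hy
  have hmAA₁ : ∀ y : A, y ∈ maximalIdeal A → (⟨(y : K), hle y.2⟩ : A₁) ∈ maximalIdeal A₁ := by
    intro y hy
    rw [mem_maximalIdeal_iff_inv_not_mem] at hy ⊢
    rcases hy with hy | hy
    · exact Or.inl hy
    · exact Or.inr fun h => hy (hdom.2 _ y.2 h)
  -- ### `x₁` and `x` are associates in `A₁`
  have hspan_le : Ideal.span ((fun y : A => (⟨(y : K), hle y.2⟩ : A₁)) '' (maximalIdeal A : Set A)) ≤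
      Ideal.span {(⟨(x : K), hle x.2⟩ : A₁)} := by
    refine Ideal.span_le.mpr ?_
    rintro _ ⟨y, hy, rfl⟩
    rw [SetLike.mem_coe, Ideal.mem_span_singleton']
    refine ⟨⟨(y : K) / x, hbl (div_mem_blowupRing (x : K) hy)⟩, Subtype.ext ?_⟩
    show (y : K) / x * x = y
    exact div_mul_cancel₀ _ hx0K
  obtain ⟨u, hu⟩ : ∃ u : A₁, u * ⟨(x : K), hle x.2⟩ = x₁ := by
    have h1 : x₁ ∈ Ideal.span {(⟨(x : K), hle x.2⟩ : A₁)} :=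
      hspan_le (hspan ▸ Ideal.mem_span_singleton_self x₁)
    exact Ideal.mem_span_singleton'.mp h1
  obtain ⟨v, hv⟩ : ∃ v : A₁, v * x₁ = ⟨(x : K), hle x.2⟩ := by
    have h1 : (⟨(x : K), hle x.2⟩ : A₁) ∈ Ideal.span {x₁} :=
      hspan ▸ Ideal.subset_span ⟨x, hx, rfl⟩
    exact Ideal.mem_span_singleton'.mp h1
  have huK : (u : K) * x = x₁ := congrArg Subtype.val hu
  have hvK : (v : K) * x₁ = x := congrArg Subtype.val hv
  have hx₁0 : ((x₁ : A₁) : K) ≠ 0 := by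
    intro h
    rw [h, mul_zero] at hvK
    exact hx0K hvK.symm
  -- ### `x ∈ 𝔪_B`, `x₁ ∈ 𝔪_{B₁}`, `θ₀ - g = x₁ θ₁ ∈ 𝔪_B`
  have hxB : (⟨(x : K), hAB x.2⟩ : B) ∈ maximalIdeal B := hmAB x hx
  have hx₁B₁ : (⟨(x₁ : K), hA₁B₁ x₁.2⟩ : B₁) ∈ maximalIdeal B₁ := by
    apply hmA₁B₁
    rw [← hu]
    exact Ideal.mul_mem_left _ _ (hmAA₁ x hx)
  have hθg : θ₀ - g = (x₁ : K) * θ₁ := by rw [hrel]; ring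
  have hθgB : θ₀ - (g : K) ∈ B := B.sub_mem hθ₀B (hAB g.2)
  have hθgmax : (⟨θ₀ - g, hθgB⟩ : B) ∈ maximalIdeal B := by
    have h1 : (⟨θ₀ - g, hBB₁ hθgB⟩ : B₁) ∈ maximalIdeal B₁ := by
      have h2 : (⟨θ₀ - g, hBB₁ hθgB⟩ : B₁) = ⟨(x₁ : K), hA₁B₁ x₁.2⟩ * ⟨θ₁, hθ₁B₁⟩ :=
        Subtype.ext hθg
      rw [h2]
      exact Ideal.mul_mem_right _ _ hx₁B₁
    rw [mem_maximalIdeal_iff_inv_not_mem] at h1 ⊢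
    rcases h1 with h1 | h1
    · exact Or.inl h1
    · exact Or.inr fun h => h1 (hBB₁ h)
  -- ### every element of `B = A[θ₀]` is `a + (θ₀ - g) c`
  have hdecomp : ∀ b ∈ B, ∃ a ∈ A, ∃ c ∈ B, b = a + (θ₀ - g) * c := by
    intro b hb
    rw [hB] at hb
    induction hb using Subring.closure_induction with
    | mem z hz =>
      rcases hz with hz | hz
      · exact ⟨z, hz, 0, B.zero_mem, by ring⟩
      · rw [Set.mem_singleton_iff] at hz
        rw [hz]
        exact ⟨g, g.2, 1, B.one_mem, by ring⟩
    | zero => exact ⟨0, A.zero_mem, 0, B.zero_mem, by ring⟩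
    | one => exact ⟨1, A.one_mem, 0, B.zero_mem, by ring⟩
    | add z w _ _ hz hw =>
      obtain ⟨a, ha, c, hc, rfl⟩ := hz
      obtain ⟨a', ha', c', hc', rfl⟩ := hw
      exact ⟨a + a', A.add_mem ha ha', c + c', B.add_mem hc hc', by ring⟩
    | neg z _ hz =>
      obtain ⟨a, ha, c, hc, rfl⟩ := hz
      exact ⟨-a, A.neg_mem ha, -c, B.neg_mem hc, by ring⟩
    | mul z w _ _ hz hw =>
      obtain ⟨a, ha, c, hc, rfl⟩ := hz
      obtain ⟨a', ha', c', hc', rfl⟩ := hw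
      refine ⟨a * a', A.mul_mem ha ha', a * c' + a' * c + (θ₀ - g) * c * c', ?_, by ring⟩
      exact B.add_mem (B.add_mem (B.mul_mem (hAB ha) hc') (B.mul_mem (hAB ha') hc))
        (B.mul_mem (B.mul_mem hθgB hc) hc')
  -- … with `a ∈ 𝔪_A` when `b ∈ 𝔪_B`
  have hdecomp' : ∀ (b : K) (hb : b ∈ B), (⟨b, hb⟩ : B) ∈ maximalIdeal B →
      ∃ a : A, a ∈ maximalIdeal A ∧ ∃ c ∈ B, b = a + (θ₀ - g) * c := by
    intro b hb hbmax
    obtain ⟨a, ha, c, hc, hbeq⟩ := hdecomp b hb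
    refine ⟨⟨a, ha⟩, ?_, c, hc, hbeq⟩
    have haB : (⟨a, hAB ha⟩ : B) ∈ maximalIdeal B := by
      have h1 : (⟨a, hAB ha⟩ : B) = ⟨b, hb⟩ - ⟨θ₀ - g, hθgB⟩ * ⟨c, hc⟩ :=
        Subtype.ext (by change a = b - (θ₀ - g) * c; rw [hbeq]; ring)
      rw [h1]
      exact Ideal.sub_mem _ hbmax (Ideal.mul_mem_right _ _ hθgmax)
    rw [mem_maximalIdeal_iff_inv_not_mem] at haB ⊢
    rcases haB with haB | haB
    · exact Or.inl haB
    · exact Or.inr fun h => haB (hAB h)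
  -- ### the chart `B[𝔪_B/x]` and `A[𝔪_A/x] ⊆ B[𝔪_B/x]`
  have hblAB : blowupRing A (x : K) ≤ blowupRing B (x : K) := by
    refine Subring.closure_le.mpr ?_
    rintro z (hz | ⟨y, hy, rfl⟩)
    · exact Subring.subset_closure (Or.inl (hAB hz))
    · exact div_mem_blowupRing (R := B) (x : K) (hmAB y hy)
  have hθgx : (θ₀ - g) / x ∈ blowupRing B (x : K) := div_mem_blowupRing (R := B) (x : K) hθgmax
  -- ### good fractions
  have good_add : ∀ z w : K,
      (∃ a ∈ blowupRing B (x : K), ∃ b ∈ blowupRing B (x : K), (b ≠ 0 ∧ b⁻¹ ∈ B₁) ∧ z = a / b) →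
      (∃ a ∈ blowupRing B (x : K), ∃ b ∈ blowupRing B (x : K), (b ≠ 0 ∧ b⁻¹ ∈ B₁) ∧ w = a / b) →
      (∃ a ∈ blowupRing B (x : K), ∃ b ∈ blowupRing B (x : K), (b ≠ 0 ∧ b⁻¹ ∈ B₁) ∧ z + w = a / b) := by
    rintro z w ⟨a, ha, b, hb, ⟨hb0, hbi⟩, rfl⟩ ⟨c, hc, d, hd, ⟨hd0, hdi⟩, rfl⟩
    refine ⟨a * d + b * c, ?_, b * d, mul_mem hb hd, ⟨mul_ne_zero hb0 hd0, ?_⟩, div_add_div a c hb0 hd0⟩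
    · exact add_mem (mul_mem ha hd) (mul_mem hb hc)
    · rw [mul_inv]; exact B₁.mul_mem hbi hdi
  have good_mul : ∀ z w : K,
      (∃ a ∈ blowupRing B (x : K), ∃ b ∈ blowupRing B (x : K), (b ≠ 0 ∧ b⁻¹ ∈ B₁) ∧ z = a / b) →
      (∃ a ∈ blowupRing B (x : K), ∃ b ∈ blowupRing B (x : K), (b ≠ 0 ∧ b⁻¹ ∈ B₁) ∧ w = a / b) →
      (∃ a ∈ blowupRing B (x : K), ∃ b ∈ blowupRing B (x : K), (b ≠ 0 ∧ b⁻¹ ∈ B₁) ∧ z * w = a / b) := by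
    rintro z w ⟨a, ha, b, hb, ⟨hb0, hbi⟩, rfl⟩ ⟨c, hc, d, hd, ⟨hd0, hdi⟩, rfl⟩
    refine ⟨a * c, mul_mem ha hc, b * d, mul_mem hb hd, ⟨mul_ne_zero hb0 hd0, ?_⟩, div_mul_div_comm a b c d⟩
    rw [mul_inv]; exact B₁.mul_mem hbi hdi
  have good_of_mem : ∀ z ∈ blowupRing B (x : K),
      ∃ a ∈ blowupRing B (x : K), ∃ b ∈ blowupRing B (x : K), (b ≠ 0 ∧ b⁻¹ ∈ B₁) ∧ z = a / b :=
    fun z hz => ⟨z, hz, 1, one_mem _, ⟨one_ne_zero, by rw [inv_one]; exact B₁.one_mem⟩, (div_one z).symm⟩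
  have good_A₁ : ∀ z ∈ A₁,
      ∃ a ∈ blowupRing B (x : K), ∃ b ∈ blowupRing B (x : K), (b ≠ 0 ∧ b⁻¹ ∈ B₁) ∧ z = a / b := by
    intro z hz
    obtain ⟨a, ha, b, hb, hbinv, rfl⟩ := hfrac z hz
    rcases eq_or_ne b 0 with rfl | hb0
    · rw [div_zero]
      exact ⟨0, zero_mem _, 1, one_mem _, ⟨one_ne_zero, by rw [inv_one]; exact B₁.one_mem⟩,
        (div_one 0).symm⟩
    · exact ⟨a, hblAB ha, b, hblAB hb, ⟨hb0, hA₁B₁ hbinv⟩, rfl⟩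
  -- ### the quadratic transform structure
  refine ⟨‹IsLocalRing B›, ⟨(x : K), hAB x.2⟩, hxB, fun h => hx0K (congrArg Subtype.val h),
    ‹IsLocalRing B₁›, ?_, ?_, ?_⟩
  · -- `B[𝔪_B/x] ⊆ B₁`
    refine Subring.closure_le.mpr ?_
    rintro z (hz | ⟨y, hy, rfl⟩)
    · exact hBB₁ hz
    · obtain ⟨a, ha, c, hc, hyeq⟩ := hdecomp' y y.2 hy
      show (y : K) / x ∈ B₁
      have h1 : ((a : A) : K) / x ∈ B₁ := hA₁B₁ (hbl (div_mem_blowupRing (x : K) ha))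
      have h2 : (θ₀ - g) * c / x = (u : K) * θ₁ * c := by
        rw [hθg, ← huK, div_eq_iff hx0K]
        ring
      rw [hyeq, add_div, h2]
      exact B₁.add_mem h1 (B₁.mul_mem (B₁.mul_mem (hA₁B₁ u.2) hθ₁B₁) (hBB₁ hc))
  · -- every element of `B₁ = A₁[θ₁]` is a good fraction
    intro z hz
    suffices h : ∃ a ∈ blowupRing B (x : K), ∃ b ∈ blowupRing B (x : K),
        (b ≠ 0 ∧ b⁻¹ ∈ B₁) ∧ z = a / b by
      obtain ⟨a, ha, b, hb, ⟨-, hbinv⟩, hzeq⟩ := h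
      exact ⟨a, ha, b, hb, hbinv, hzeq⟩
    rw [hB₁] at hz
    induction hz using Subring.closure_induction with
    | mem z hz =>
      rcases hz with hz | hz
      · exact good_A₁ z hz
      · rw [Set.mem_singleton_iff] at hz
        rw [hz]
        have hθ₁eq : θ₁ = (v : K) * ((θ₀ - g) / x) := by
          rw [hθg, ← hvK, ← mul_div_assoc, eq_div_iff (hvK.symm ▸ hx0K : (v : K) * x₁ ≠ 0)]
          ring
        rw [hθ₁eq]
        exact good_mul _ _ (good_A₁ _ v.2) (good_of_mem _ hθgx)
    | zero => exact good_of_mem 0 (zero_mem _)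
    | one => exact good_of_mem 1 (one_mem _)
    | add z w _ _ hz hw => exact good_add z w hz hw
    | neg z _ hz =>
      obtain ⟨a, ha, b, hb, hbg, rfl⟩ := hz
      exact ⟨-a, neg_mem ha, b, hb, hbg, by rw [neg_div]⟩
    | mul z w _ _ hz hw => exact good_mul z w hz hw
  · -- `B₁` dominates `B`
    refine ⟨hBB₁, fun y hyB hinv => ?_⟩
    by_contra hyinvB
    have hy0 : y ≠ 0 := by
      rintro rfl
      exact hyinvB (by rw [inv_zero]; exact B.zero_mem)
    have hymax : (⟨y, hyB⟩ : B) ∈ maximalIdeal B :=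
      (mem_maximalIdeal_iff_inv_not_mem _).mpr (Or.inr hyinvB)
    obtain ⟨a, ha, c, hc, hyeq⟩ := hdecomp' y hyB hymax
    have hymax₁ : (⟨y, hBB₁ hyB⟩ : B₁) ∈ maximalIdeal B₁ := by
      have h1 : (⟨y, hBB₁ hyB⟩ : B₁) = ⟨((a : A) : K), hA₁B₁ (hle a.2)⟩ +
          ⟨(x₁ : K), hA₁B₁ x₁.2⟩ * (⟨θ₁, hθ₁B₁⟩ * ⟨c, hBB₁ hc⟩) :=
        Subtype.ext (by change y = (a : K) + (x₁ : K) * (θ₁ * c); rw [hyeq, hθg]; ring)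
      rw [h1]
      exact Ideal.add_mem _ (hmA₁B₁ _ (hmAA₁ a ha)) (Ideal.mul_mem_right _ _ hx₁B₁)
    rcases (mem_maximalIdeal_iff_inv_not_mem _).mp hymax₁ with h | h
    · exact hy0 h
    · exact h hinv

end Adjoin

section Range

variable {S : Type u} [CommRing S] {T : Type v} [CommRing T]

/-- The image of `S[X]/(F) → T`, `X ↦ a`, is the subring generated by `i(S)` and `a`. [folklore] -/
theorem range_adjoinRoot_lift (F : Polynomial S) (i : S →+* T) (a : T) (h : F.eval₂ i a = 0) :
    (AdjoinRoot.lift i a h).range = Subring.closure ((i.range : Set T) ∪ {a}) := by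
  apply le_antisymm
  · rintro _ ⟨z, rfl⟩
    induction z using AdjoinRoot.induction_on with
    | ih q =>
      rw [AdjoinRoot.lift_mk]
      induction q using Polynomial.induction_on with
      | C r =>
        rw [Polynomial.eval₂_C]
        exact Subring.subset_closure (Or.inl ⟨r, rfl⟩)
      | add q₁ q₂ h₁ h₂ =>
        rw [Polynomial.eval₂_add]
        exact add_mem h₁ h₂
      | monomial n r _ =>
        rw [Polynomial.eval₂_mul, Polynomial.eval₂_C, Polynomial.eval₂_X_pow]
        have hr : i r ∈ Subring.closure ((i.range : Set T) ∪ {a}) :=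
          Subring.subset_closure (Or.inl ⟨r, rfl⟩)
        have ha : a ∈ Subring.closure ((i.range : Set T) ∪ {a}) :=
          Subring.subset_closure (Or.inr rfl)
        exact mul_mem hr (pow_mem ha _)
  · refine Subring.closure_le.mpr ?_
    rintro z (⟨r, rfl⟩ | hz)
    · exact ⟨AdjoinRoot.of F r, AdjoinRoot.lift_of h⟩
    · rw [Set.mem_singleton_iff] at hz
      rw [hz]
      exact ⟨AdjoinRoot.root F, AdjoinRoot.lift_root h⟩

end Range

end RadicandChainAdjoin

end Summit.ResolutionOfSingularities.ResolutionOfSingularities.Theorems.SwitchingDichotomy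

end
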